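import Mathlib.Analysis.InnerProductSpace.PiL2
import Mathlib.Analysis.InnerProductSpace.GramSchmidtOrtho
import HarnessLib

/-!
# Assembly toolkit I (crux `ZeroDefectDensity`, line `birth`, stub `stub_assembly`): explicit
# Gram–Schmidt frames, coordinates, and interval lemmas

Support file for the assembly step of the reshaped line (lead c4): the rescaled soft shell of a
softly twelve-kissed particle is compared with the fcc/hcp pattern in an orthonormal frame obtained by
Gram–Schmidt from three explicit combinations of shell vectors.  This file is pattern-free: it provides

* `gs_orthonormal` / `exists_orthonormalBasis_of_orthonormal` — the explicit three-step Gram–Schmidt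
  frame `b₁ = ‖v₁‖⁻¹ • v₁`, `b₂ = ‖w₂‖⁻¹ • w₂` (`w₂ = v₂ - ⟪v₂,b₁⟫ b₁`), `b₃ = ‖w₃‖⁻¹ • w₃`
  (`w₃ = v₃ - ⟪v₃,b₁⟫ b₁ - ⟪v₃,b₂⟫ b₂`) is orthonormal and (dimension three) an orthonormal basis;
* `inner_gs₁`, `inner_gs_residual`, `inner_gs_residual₂`, `norm_sq_residual`, `norm_sq_residual₂` —
  the coordinates of any vector in that frame in terms of inner products with `v₁, v₂, v₃`;
* `exists_linearIsometry_onb` and `norm_sub_map_sq` — the linear isometry carrying one orthonormal basis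
  to another, and Parseval's identity for the error;
* `abs_div_sub_div_le`, `abs_sub_le_of_sq`, `dist_inv_smul_le` — the three interval lemmas used to
  propagate explicit error bounds.

All statements are elementary; no facts are cited. [folklore]
-/

noncomputable section

namespace Summit.AtomisticToContinuum.Crystallization.Theorems.ZeroDefectDensityBirth

open Real RealInnerProductSpace

/-! ### Interval lemmas -/

/-- Quotients of approximately known quantities: if `|p - N| ≤ eₙ`, `|q - D| ≤ e_d` and `D - e_d > 0`
then `|p/q - N/D| ≤ (eₙ + |N|·e_d/D)/(D - e_d)`. [folklore] -/
theorem abs_div_sub_div_le {p q N D en ed : ℝ} (hp : |p - N| ≤ en) (hq : |q - D| ≤ ed)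
    (hD : 0 < D - ed) (hDpos : 0 < D) :
    |p / q - N / D| ≤ (en + |N| * ed / D) / (D - ed) := by
  have hq0 : 0 < q := by
    have := (abs_sub_le_iff.1 hq).2
    linarith
  have hen : 0 ≤ en := le_trans (abs_nonneg _) hp
  have hed : 0 ≤ ed := le_trans (abs_nonneg _) hq
  have key : p / q - N / D = ((p - N) * D - N * (q - D)) / (q * D) := by
    field_simp
    ring
  rw [key, abs_div, abs_mul, abs_of_pos hq0, abs_of_pos hDpos]
  have hnum : |(p - N) * D - N * (q - D)| ≤ en * D + |N| * ed := by
    calc |(p - N) * D - N * (q - D)| ≤ |(p - N) * D| + |N * (q - D)| := abs_sub _ _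
      _ = |p - N| * D + |N| * |q - D| := by rw [abs_mul, abs_mul, abs_of_pos hDpos]
      _ ≤ en * D + |N| * ed := by gcongr
  have hqD : (D - ed) * D ≤ q * D := by
    have : D - ed ≤ q := by
      have := (abs_sub_le_iff.1 hq).2
      linarith
    exact mul_le_mul_of_nonneg_right this hDpos.le
  calc |(p - N) * D - N * (q - D)| / (q * D) ≤ (en * D + |N| * ed) / (q * D) := by
        gcongr
    _ ≤ (en * D + |N| * ed) / ((D - ed) * D) := by
        apply div_le_div_of_nonneg_left _ (mul_pos hD hDpos) hqD
        positivity
    _ = (en + |N| * ed / D) / (D - ed) := by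
        field_simp

/-- Square roots of approximately known squares: if `s ≥ 0`, `S > 0` and `|s² - S²| ≤ e` then
`|s - S| ≤ e/S`. [folklore] -/
theorem abs_sub_le_of_sq {s S e : ℝ} (hs : 0 ≤ s) (hS : 0 < S) (h : |s ^ 2 - S ^ 2| ≤ e) :
    |s - S| ≤ e / S := by
  have hsum : 0 < s + S := by linarith
  have key : s - S = (s ^ 2 - S ^ 2) / (s + S) := by
    field_simp
    ring
  rw [key, abs_div, abs_of_pos hsum]
  calc |s ^ 2 - S ^ 2| / (s + S) ≤ e / (s + S) := by gcongr
    _ ≤ e / S := by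
        apply div_le_div_of_nonneg_left (le_trans (abs_nonneg _) h) hS
        linarith

/-- From a bound on `|s² - S²|` with `S > 0`, `s ≥ 0`: the two-sided bound `S - e/S ≤ s ≤ S + e/S`.
[folklore] -/
theorem sub_le_and_le_add_of_sq {s S e : ℝ} (hs : 0 ≤ s) (hS : 0 < S) (h : |s ^ 2 - S ^ 2| ≤ e) :
    S - e / S ≤ s ∧ s ≤ S + e / S := by
  have := abs_sub_le_iff.1 (abs_sub_le_of_sq hs hS h)
  constructor <;> linarith [this.1, this.2]

/-- Rescaling a near-unit vector: if `‖x - y‖ ≤ δ` and `d > 0` then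
`dist (d⁻¹ • x) y ≤ d⁻¹ * δ + |d⁻¹ - 1| * ‖y‖`. [folklore] -/
theorem dist_inv_smul_le {F : Type*} [NormedAddCommGroup F] [NormedSpace ℝ F] {x y : F} {d δ : ℝ}
    (hd : 0 < d) (hxy : ‖x - y‖ ≤ δ) :
    dist (d⁻¹ • x) y ≤ d⁻¹ * δ + |d⁻¹ - 1| * ‖y‖ := by
  have key : d⁻¹ • x - y = d⁻¹ • (x - y) + (d⁻¹ - 1) • y := by
    rw [smul_sub, sub_smul, one_smul]
    abel
  rw [dist_eq_norm, key]
  calc ‖d⁻¹ • (x - y) + (d⁻¹ - 1) • y‖ ≤ ‖d⁻¹ • (x - y)‖ + ‖(d⁻¹ - 1) • y‖ := norm_add_le _ _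
    _ = d⁻¹ * ‖x - y‖ + |d⁻¹ - 1| * ‖y‖ := by
        rw [norm_smul, norm_smul, Real.norm_of_nonneg (inv_pos.2 hd).le, Real.norm_eq_abs]
    _ ≤ d⁻¹ * δ + |d⁻¹ - 1| * ‖y‖ := by
        gcongr

/-! ### Explicit Gram–Schmidt in three steps -/

section GS

variable {F : Type*} [NormedAddCommGroup F] [InnerProductSpace ℝ F]

/-- First Gram–Schmidt vector: coordinates. `⟪x, ‖v‖⁻¹ • v⟫ = ⟪x, v⟫ / ‖v‖`. [folklore] -/
theorem inner_gs₁ (x v : F) : ⟪x, ‖v‖⁻¹ • v⟫ = ⟪x, v⟫ / ‖v‖ := by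
  rw [real_inner_smul_right, div_eq_inv_mul]

/-- The Gram–Schmidt residual `w = v - ⟪v, b⟫ b` against a unit vector `b` is orthogonal to `b`.
[folklore] -/
theorem inner_residual_eq_zero {v b : F} (hb : ‖b‖ = 1) : ⟪v - ⟪v, b⟫ • b, b⟫ = 0 := by
  rw [inner_sub_left, real_inner_smul_left, real_inner_self_eq_norm_sq, hb]
  ring

/-- Norm of the Gram–Schmidt residual against a unit vector: `‖v - ⟪v,b⟫ b‖² = ‖v‖² - ⟪v,b⟫²`.
[folklore] -/
theorem norm_sq_residual {v b : F} (hb : ‖b‖ = 1) : ‖v - ⟪v, b⟫ • b‖ ^ 2 = ‖v‖ ^ 2 - ⟪v, b⟫ ^ 2 := by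
  rw [@norm_sub_sq_real, norm_smul, Real.norm_eq_abs, hb, mul_one, sq_abs, real_inner_smul_right,
    real_inner_comm]
  ring

/-- Coordinates along the normalised residual: for a unit vector `b` and `w = v - ⟪v,b⟫ b ≠ 0`,
`⟪x, ‖w‖⁻¹ • w⟫ = (⟪x, v⟫ - ⟪v, b⟫ * ⟪x, b⟫) / ‖w‖`. [folklore] -/
theorem inner_gs_residual (x v b : F) :
    ⟪x, ‖v - ⟪v, b⟫ • b‖⁻¹ • (v - ⟪v, b⟫ • b)⟫ =
      (⟪x, v⟫ - ⟪v, b⟫ * ⟪x, b⟫) / ‖v - ⟪v, b⟫ • b‖ := by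
  rw [real_inner_smul_right, inner_sub_right, real_inner_smul_right, div_eq_inv_mul]

/-- The double residual `w = v - ⟪v,b⟫ b - ⟪v,b'⟫ b'` against two orthonormal vectors is orthogonal to
both. [folklore] -/
theorem inner_residual₂_eq_zero {v b b' : F} (hb : ‖b‖ = 1) (hb' : ‖b'‖ = 1) (hbb' : ⟪b, b'⟫ = 0) :
    ⟪v - ⟪v, b⟫ • b - ⟪v, b'⟫ • b', b⟫ = 0 ∧ ⟪v - ⟪v, b⟫ • b - ⟪v, b'⟫ • b', b'⟫ = 0 := by
  have hb'b : ⟪b', b⟫ = 0 := by rw [real_inner_comm]; exact hbb'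
  constructor
  · rw [inner_sub_left, inner_sub_left, real_inner_smul_left, real_inner_smul_left,
      real_inner_self_eq_norm_sq, hb, hb'b]
    ring
  · rw [inner_sub_left, inner_sub_left, real_inner_smul_left, real_inner_smul_left,
      real_inner_self_eq_norm_sq, hb', hbb']
    ring

/-- Norm of the double residual: `‖v - ⟪v,b⟫ b - ⟪v,b'⟫ b'‖² = ‖v‖² - ⟪v,b⟫² - ⟪v,b'⟫²` for
orthonormal `b, b'`. [folklore] -/
theorem norm_sq_residual₂ {v b b' : F} (hb : ‖b‖ = 1) (hb' : ‖b'‖ = 1) (hbb' : ⟪b, b'⟫ = 0) :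
    ‖v - ⟪v, b⟫ • b - ⟪v, b'⟫ • b'‖ ^ 2 = ‖v‖ ^ 2 - ⟪v, b⟫ ^ 2 - ⟪v, b'⟫ ^ 2 := by
  have h1 : ‖v - ⟪v, b⟫ • b - ⟪v, b'⟫ • b'‖ ^ 2 =
      ‖v - ⟪v, b⟫ • b‖ ^ 2 - 2 * ⟪v - ⟪v, b⟫ • b, ⟪v, b'⟫ • b'⟫ + ‖⟪v, b'⟫ • b'‖ ^ 2 :=
    @norm_sub_sq_real _ _ _ _ _
  have hmid : ⟪v - ⟪v, b⟫ • b, ⟪v, b'⟫ • b'⟫ = ⟪v, b'⟫ ^ 2 := by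
    rw [real_inner_smul_right, inner_sub_left, real_inner_smul_left, hbb', mul_zero, sub_zero]
    ring
  have hn : ‖⟪v, b'⟫ • b'‖ ^ 2 = ⟪v, b'⟫ ^ 2 := by
    rw [norm_smul, hb', mul_one, Real.norm_eq_abs, sq_abs]
  rw [h1, norm_sq_residual hb, hmid, hn]
  ring

/-- Coordinates along the normalised double residual. [folklore] -/
theorem inner_gs_residual₂ (x v b b' : F) :
    ⟪x, ‖v - ⟪v, b⟫ • b - ⟪v, b'⟫ • b'‖⁻¹ • (v - ⟪v, b⟫ • b - ⟪v, b'⟫ • b')⟫ =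
      (⟪x, v⟫ - ⟪v, b⟫ * ⟪x, b⟫ - ⟪v, b'⟫ * ⟪x, b'⟫) / ‖v - ⟪v, b⟫ • b - ⟪v, b'⟫ • b'‖ := by
  rw [real_inner_smul_right, inner_sub_right, inner_sub_right, real_inner_smul_right,
    real_inner_smul_right, div_eq_inv_mul]

/-- **The explicit Gram–Schmidt frame is orthonormal.**  With `b₁ = ‖v₁‖⁻¹ • v₁`,
`w₂ = v₂ - ⟪v₂,b₁⟫ b₁`, `b₂ = ‖w₂‖⁻¹ • w₂`, `w₃ = v₃ - ⟪v₃,b₁⟫ b₁ - ⟪v₃,b₂⟫ b₂`, `b₃ = ‖w₃‖⁻¹ • w₃`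
and `v₁, w₂, w₃ ≠ 0`, the family `![b₁, b₂, b₃]` is orthonormal. [folklore] -/
theorem gs_orthonormal {v₁ v₂ v₃ b₁ b₂ b₃ : F} (hv₁ : v₁ ≠ 0) (hb₁ : b₁ = ‖v₁‖⁻¹ • v₁)
    (hw₂ : v₂ - ⟪v₂, b₁⟫ • b₁ ≠ 0) (hb₂ : b₂ = ‖v₂ - ⟪v₂, b₁⟫ • b₁‖⁻¹ • (v₂ - ⟪v₂, b₁⟫ • b₁))
    (hw₃ : v₃ - ⟪v₃, b₁⟫ • b₁ - ⟪v₃, b₂⟫ • b₂ ≠ 0)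
    (hb₃ : b₃ = ‖v₃ - ⟪v₃, b₁⟫ • b₁ - ⟪v₃, b₂⟫ • b₂‖⁻¹ • (v₃ - ⟪v₃, b₁⟫ • b₁ - ⟪v₃, b₂⟫ • b₂)) :
    Orthonormal ℝ ![b₁, b₂, b₃] := by
  -- `‖‖v‖⁻¹ • v‖ = 1` for `v ≠ 0` (cf. `norm_normalise` in the TwoCentreKissingKernel files)
  have nrm : ∀ {v : F}, v ≠ 0 → ‖‖v‖⁻¹ • v‖ = 1 := fun {v} hv => by
    rw [norm_smul, norm_inv, norm_norm, inv_mul_cancel₀ (norm_ne_zero_iff.2 hv)]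
  have n1 : ‖b₁‖ = 1 := by rw [hb₁]; exact nrm hv₁
  have n2 : ‖b₂‖ = 1 := by rw [hb₂]; exact nrm hw₂
  have n3 : ‖b₃‖ = 1 := by rw [hb₃]; exact nrm hw₃
  have o12 : ⟪b₁, b₂⟫ = 0 := by
    rw [hb₂, real_inner_smul_right, real_inner_comm (v₂ - ⟪v₂, b₁⟫ • b₁) b₁,
      inner_residual_eq_zero n1, mul_zero]
  have o13 : ⟪b₁, b₃⟫ = 0 := by
    rw [hb₃, real_inner_smul_right, real_inner_comm (v₃ - ⟪v₃, b₁⟫ • b₁ - ⟪v₃, b₂⟫ • b₂) b₁,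
      (inner_residual₂_eq_zero n1 n2 o12).1, mul_zero]
  have o23 : ⟪b₂, b₃⟫ = 0 := by
    rw [hb₃, real_inner_smul_right, real_inner_comm (v₃ - ⟪v₃, b₁⟫ • b₁ - ⟪v₃, b₂⟫ • b₂) b₂,
      (inner_residual₂_eq_zero n1 n2 o12).2, mul_zero]
  have o21 : ⟪b₂, b₁⟫ = 0 := by rw [real_inner_comm]; exact o12
  have o31 : ⟪b₃, b₁⟫ = 0 := by rw [real_inner_comm]; exact o13
  have o32 : ⟪b₃, b₂⟫ = 0 := by rw [real_inner_comm]; exact o23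
  rw [orthonormal_iff_ite]
  intro i j
  fin_cases i <;> fin_cases j <;>
    simp [n1, n2, n3, o12, o13, o23, o21, o31, o32]

end GS

/-- **An orthonormal triple of `ℝ³` is an orthonormal basis.** [folklore] -/
theorem exists_orthonormalBasis_of_orthonormal {b : Fin 3 → (EuclideanSpace ℝ (Fin 3))} (hb : Orthonormal ℝ b) :
    ∃ B : OrthonormalBasis (Fin 3) ℝ (EuclideanSpace ℝ (Fin 3)), ⇑B = b := by
  have hsp : ⊤ ≤ Submodule.span ℝ (Set.range b) := by
    rw [hb.linearIndependent.span_eq_top_of_card_eq_finrank' (by simp)]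
  exact ⟨OrthonormalBasis.mk hb hsp, OrthonormalBasis.coe_mk hb hsp⟩

/-- **Carrying one orthonormal basis to another by a linear isometry.** [folklore] -/
theorem exists_linearIsometry_onb (B C : OrthonormalBasis (Fin 3) ℝ (EuclideanSpace ℝ (Fin 3))) :
    ∃ A : (EuclideanSpace ℝ (Fin 3)) →ₗᵢ[ℝ] (EuclideanSpace ℝ (Fin 3)), ∀ i, A (B i) = C i := by
  classical
  refine ⟨(B.repr.trans C.repr.symm).toLinearIsometry, fun i => ?_⟩
  change C.repr.symm (B.repr (B i)) = C i
  rw [B.repr_self, C.repr_symm_single]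

/-- **Parseval for the error.**  For an orthonormal basis `C` of `ℝ³`, a vector `x`, and a linear
isometry `A` with `A (B i) = C i`: `‖x - A q‖² = Σᵢ (⟪x, C i⟫ - ⟪q, B i⟫)²`. [folklore] -/
theorem norm_sub_map_sq' (B C : OrthonormalBasis (Fin 3) ℝ (EuclideanSpace ℝ (Fin 3))) (A : (EuclideanSpace ℝ (Fin 3)) →ₗᵢ[ℝ] (EuclideanSpace ℝ (Fin 3)))
    (hA : ∀ i, A (B i) = C i) (x q : (EuclideanSpace ℝ (Fin 3))) :
    ‖x - A q‖ ^ 2 = ∑ i, (⟪x, C i⟫ - ⟪q, B i⟫) ^ 2 := by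
  have hq : A q = ∑ i, ⟪q, B i⟫ • C i := by
    conv_lhs => rw [← B.sum_repr' q]
    rw [map_sum]
    refine Finset.sum_congr rfl fun i _ => ?_
    rw [LinearIsometry.map_smul, hA, real_inner_comm]
  rw [← C.sum_sq_inner_left (x - A q)]
  refine Finset.sum_congr rfl fun i _ => ?_
  rw [inner_sub_left, hq, sum_inner]
  congr 1
  simp_rw [real_inner_smul_left]
  have : ∀ j, ⟪C j, C i⟫ = if j = i then 1 else 0 := fun j => by
    rw [orthonormal_iff_ite.1 C.orthonormal]
  simp_rw [this, mul_ite, mul_one, mul_zero]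
  rw [Finset.sum_ite_eq' Finset.univ i]
  simp

/-- **Parseval for the error** (registered sub-goal form of `norm_sub_map_sq'`). [folklore] -/
theorem norm_sub_map_sq : ∀ (B C : OrthonormalBasis (Fin 3) ℝ (EuclideanSpace ℝ (Fin 3))) (A : EuclideanSpace ℝ (Fin 3) →ₗᵢ[ℝ] EuclideanSpace ℝ (Fin 3)), (∀ i, A (B i) = C i) → ∀ (x q : EuclideanSpace ℝ (Fin 3)), ‖x - A q‖ ^ 2 = ∑ i, (inner ℝ x (C i) - inner ℝ q (B i)) ^ 2 :=
  fun B C A hA x q => norm_sub_map_sq' B C A hA x q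

/-- Parseval, bound form: if each coordinate error is at most `εᵢ` then
`‖x - A q‖² ≤ Σ εᵢ²`. [folklore] -/
theorem norm_sub_map_sq_le (B C : OrthonormalBasis (Fin 3) ℝ (EuclideanSpace ℝ (Fin 3))) (A : (EuclideanSpace ℝ (Fin 3)) →ₗᵢ[ℝ] (EuclideanSpace ℝ (Fin 3)))
    (hA : ∀ i, A (B i) = C i) (x q : (EuclideanSpace ℝ (Fin 3))) (ε : Fin 3 → ℝ)
    (h : ∀ i, |⟪x, C i⟫ - ⟪q, B i⟫| ≤ ε i) :
    ‖x - A q‖ ^ 2 ≤ ∑ i, ε i ^ 2 := by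
  rw [norm_sub_map_sq' B C A hA]
  refine Finset.sum_le_sum fun i _ => ?_
  have := h i
  rw [← sq_abs]
  exact pow_le_pow_left₀ (abs_nonneg _) this 2

end Summit.AtomisticToContinuum.Crystallization.Theorems.ZeroDefectDensityBirth

end
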